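import Literature.Analysis.FluidPDE.TorusNSLadderInequality
import HarnessLib

/-!
# The Doering–Gibbon ladder controlled by `‖u‖_∞`: `|NL_N| ≤ c_N H_N^{1/2} H_{N+1}^{1/2} ‖u‖_∞` and
# `½ Ḟ_N ≤ −(ν/2) F_{N+1} + (c_N ν⁻¹ ‖u‖²_∞ + ν λ₀⁻²) F_N`, every rung

search for candidate a priori estimates; no regularity claim (cell `pub-nsfunc`, literature seat:
this file types a PUBLISHED inequality, nothing new).

Analysis/FluidPDE proof file (theorems only; no definitions, no named facts), sequel of
`TorusNSLadderInequality`. Doering–Gibbon 1995 record, besides the `‖Du‖_∞`-ladder of Thm 6.1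
((6.2.5)/(6.2.27), typed in `TorusNSLadderInequality`), "an alternative version of the `H_N` and `F_N`
ladders which depend on `‖u‖²_∞` instead of `‖Du‖_∞`" (the "second `F_N` ladder" of Table 6.1;
Ch. 6, Exercise 3): the nonlinear term of the `H_N`-balance obeys

  `|∫ Dᴺu · Dᴺ[(u·∇)u]| ≤ c_N H_N^{1/2} H_{N+1}^{1/2} ‖u‖_∞`        (E6.8)

and hence

  `½ Ḟ_N ≤ −(ν/2) F_N^{1+1/s}/F_{N−s}^{1/s} + (c_N ν⁻¹ ‖u‖²_∞ + ν λ₀⁻²) F_N`.   (E6.9)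

This file proves both at EVERY rung `N ≥ 1` (written `N = n + 1`), in every dimension `d`, for smooth
fields / classical solutions `Torus.IsClassicalNSSolutionOn (Icc a b) ν f u p` on the unit torus, with
`H_N = E_N = Torus.wordEnergy N` and `‖u‖_∞` rendered as any pointwise bound `‖u(t,x)‖ ≤ A`:

* `Torus.exists_abs_ladderNonlinear_le_sup` — **(E6.8)**: `|NL_{n+1}(v)| ≤ c A E_{n+1}(v)^{1/2} E_{n+2}(v)^{1/2}`
  for every smooth `v` with `‖v‖ ≤ A` (no divergence condition is needed). Proof: one integration by
  parts on the outer letter, `∫⟪∂ᵢ∂^{w}G, ∂ᵢ∂^{w}v⟫ = −∫⟪∂^{w}G, ∂ᵢ∂ᵢ∂^{w}v⟫`, `G = (v·∇)v`; Leibniz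
  (`Torus.wordDeriv_convect_apply`): `∂^w G = (v·∇)∂^w v + ∑ⱼ ∑_{(α,β)} ∂^α vⱼ • ∂^β ∂ⱼv`; the top term
  is `≤ ‖v‖_∞ |∇∂^w v|` pointwise, each commutator term has
  `‖∂^α v ∂^β∂ⱼv‖₂² ≤ ∫ |∇^{|α|}v|² |∇^{n+1−|α|}v|² ≤ C ‖v‖²_∞ E_{n+1}(v)` by the bilinear
  Gagliardo–Nirenberg inequality of the tree (`Torus.exists_integral_wordGradSq_mul_le_two`, Doering–Gibbon
  (A.0.19)–(A.0.21) with `f = v` itself in place of `f = ∂v`); Cauchy–Schwarz.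
* `Torus.exists_ladder_inequality_sup` — the `H_N`-ladder: along a classical solution, at every
  `t ∈ [a, b]` with `‖u(t, x)‖ ≤ A`,
  `d/dt ½E_{n+1}(u) ≤ −ν E_{n+2}(u) + c A E_{n+1}^{1/2}E_{n+2}^{1/2} + E_{n+1}(u)^{1/2}E_{n+1}(f)^{1/2}`
  (any `ν`, Euler included), and `Torus.exists_ladder_inequality_sup_sq` — after Young, for `ν > 0`:
  `d/dt ½E_{n+1}(u) ≤ −(ν/2) E_{n+2}(u) + (c²/(2ν)) A² E_{n+1}(u) + E_{n+1}(u)^{1/2}E_{n+1}(f)^{1/2}`.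
* `Torus.exists_wordEnergy_le_mul_exp_integral_sup` — Grönwall against `∫ ‖u‖²_∞` (unforced,
  `ν > 0`): for a continuous majorant `‖u(s, x)‖ ≤ A(s)` on `[a, b]`,
  `E_{n+1}(u(t)) ≤ E_{n+1}(u(a)) exp((c²/ν) ∫ₐᵗ A²)` — every rung stays bounded as long as
  `∫ ‖u‖²_∞ dt` does (the Serrin class `L²_t L^∞_x` seen rung by rung).
* `Torus.exists_ladderF_inequality_sup`, `Torus.exists_ladderF_inequality_sup_rpow` — **(E6.9)** for
  `F_N = ladderF ν N f (u t) = H_N + ν⁻²Φ_N` under a time-independent forcing with the spectral cutoff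
  `Φ_{N+1} ≤ Λ Φ_N` (`λ₀⁻² = Λ + 1` on the unit torus):
  `½Ḟ_{n+1} ≤ −(ν/2)F_{n+2} + (c²(2ν)⁻¹A² + (ν/2)(Λ+1))F_{n+1}` and, with Lemma 6.3,
  `½Ḟ_{n+1} ≤ −(ν/2)F_{n+1}^{1+1/s}/F_{n+1−s}^{1/s} + (…)F_{n+1}`, `1 ≤ s ≤ n + 1`.

Faithfulness: Doering–Gibbon state (E6.8)–(E6.9) on `[0, L]^d` with inexplicit `c_N` and derive (E6.8)
from the rotational form (E6.7) `uₜ + ω × u = νΔu − ∇(p + u²/2) + f` and Lemma 6.2; here the unit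
torus, inexplicit `c = c(card d, n)`, and the proof integrates by parts once in the convective form
instead (the same calculus inequalities); the printed `νλ₀⁻²` appears as `(ν/2)(Λ+1)`.
-- TODO(general form): box length `L`, explicit constants.

## Mathlib / tree search

Tree (reused): `TorusNSLadderInequality` (`ladderNonlinear`, `wordForcing`, `ladderF`,
`wordDeriv_convect_apply`, `exists_integral_wordGradSq_mul_le_two`, `norm_sq_wordDeriv_list_le_wordGradSq`,
`abs_integral_inner_le_sqrt_mul_sqrt_of_isSmooth`, `abs_wordForcing_le`, `ladderF_pow_le_pow_mul_pow`,
`IsClassicalNSSolutionOn.hasDerivWithinAt_half_wordEnergy`), `TorusWordGagliardoNirenberg` (`wordGradSq`),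
`TorusWordL2Bounds` (`lowerSplits`, `mem_lowerSplits`, `list_map_sum_eq_sum_fin`), `TorusWordVectorCalculus`
(`lowCommS`, `wordDeriv_apply_coord`), `TorusWordEnergy` (`wordEnergy_succ'`,
`sum_integral_norm_sq_partialDeriv_wordDeriv_le`, `integral_norm_sq_wordDeriv_le_wordEnergy`),
`TorusFluidGlueProofs` (`integral_inner_partialDeriv_eq_neg`), `ExtremeGrowthVorticityControl`
(`le_mul_exp_integral_of_hasDerivWithinAt_le_mul`). Searched `ladderNonlinear`, `sup.*wordEnergy`,
`‖u‖_∞.*H_N`: only the `‖Du‖_∞` ladder and the rung `N = 1` (`TorusNSWavenumberTimeAverages`, (7.3.3))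
exist.

## References

* C. R. Doering, J. D. Gibbon, *Applied Analysis of the Navier–Stokes Equations*, CUP 1995, §6.5
  Table 6.1 ("2nd `F_N` ladder") and Ch. 6 Exercise 3, (E6.7)–(E6.9) (held:
  `book:doering1995-applied-analysis-navier-stokes-equations`, chunks p0106, p0112). [DoeringGibbon1995]
* M. Bartuccelli, C. R. Doering, J. D. Gibbon, S. J. A. Malham, *Length scales in solutions of the
  Navier–Stokes equations*, Nonlinearity 6 (1993) 549–568.
-/

noncomputable section

open MeasureTheory Set Function Real
open scoped ContDiff InnerProductSpace RealInnerProductSpace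

namespace Literature.Analysis.FluidPDE

namespace Torus

open FunctionSpaces FunctionSpaces.Torus

variable {d : Type*} [Fintype d] [DecidableEq d]

/-! ## The nonlinear term against `‖u‖_∞` (E6.8) -/

/-- A uniform constant over `k ≤ m` for the two-function bilinear Gagliardo–Nirenberg bound
(`Torus.exists_integral_wordGradSq_mul_le_two` for every `k`, constants summed). [folklore] -/
private theorem exists_uniform_bilinear' (d : Type*) [Fintype d] [DecidableEq d] (F' : Type*)
    [NormedAddCommGroup F'] [InnerProductSpace ℝ F'] (m : ℕ) :
    ∃ C : ℝ, 0 ≤ C ∧ ∀ k, k ≤ m → ∀ (f₁ f₂ : UnitAddTorus d → F'), IsSmooth f₁ → IsSmooth f₂ → ∀ A : ℝ,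
      (∀ x, ‖f₁ x‖ ≤ A) → (∀ x, ‖f₂ x‖ ≤ A) →
        ∫ x, wordGradSq k f₁ x * wordGradSq (m - k) f₂ x ≤ C * A ^ 2 * (wordEnergy m f₁ + wordEnergy m f₂) := by
  classical
  set c : ℕ → ℝ := fun k => if hk : k ≤ m then Classical.choose (exists_integral_wordGradSq_mul_le_two d F' hk) else 0
    with hc
  have hc0 : ∀ k, 0 ≤ c k := fun k => by
    simp only [hc]; split_ifs with hk
    · exact (Classical.choose_spec (exists_integral_wordGradSq_mul_le_two d F' hk)).1
    · exact le_rfl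
  refine ⟨∑ k ∈ Finset.range (m + 1), c k, Finset.sum_nonneg fun k _ => hc0 k, ?_⟩
  intro k hk f₁ f₂ hf₁ hf₂ A hA₁ hA₂
  have hspec := (Classical.choose_spec (exists_integral_wordGradSq_mul_le_two d F' hk)).2 f₁ f₂ hf₁ hf₂ A hA₁ hA₂
  have hck : Classical.choose (exists_integral_wordGradSq_mul_le_two d F' hk) = c k := by simp only [hc, dif_pos hk]
  rw [hck] at hspec
  refine hspec.trans (mul_le_mul_of_nonneg_right (mul_le_mul_of_nonneg_right ?_ (sq_nonneg A))
    (add_nonneg (wordEnergy_nonneg _ _) (wordEnergy_nonneg _ _)))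
  exact Finset.single_le_sum (f := c) (fun k _ => hc0 k) (Finset.mem_range.2 (Nat.lt_succ_of_le hk))

variable {v : UnitAddTorus d → EuclideanSpace ℝ d}

/-- `‖(u·∇)U (x)‖ ≤ ‖u(x)‖ (∑ᵢ ‖∂ᵢU(x)‖²)^{1/2}` (`DU(x)h = ∑ᵢ hᵢ ∂ᵢU(x)`, Cauchy–Schwarz in `ℝ^d`).
[folklore] -/
private theorem norm_convect_le_norm_mul_sqrt' {u U : UnitAddTorus d → EuclideanSpace ℝ d}
    (hU : IsSmooth U) (x : UnitAddTorus d) :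
    ‖Torus.convect u U x‖ ≤ ‖u x‖ * Real.sqrt (∑ i, ‖Torus.partialDeriv i U x‖ ^ 2) := by
  have h1 : Torus.convect u U x = ∑ i, (u x) i • Torus.partialDeriv i U x :=
    Torus.fderiv_apply_eq_sum_partialDeriv (hU.isContDiff (by simp)) x (u x)
  rw [h1]
  calc ‖∑ i, (u x) i • Torus.partialDeriv i U x‖
      ≤ ∑ i, ‖(u x) i • Torus.partialDeriv i U x‖ := norm_sum_le _ _
    _ = ∑ i, |(u x) i| * ‖Torus.partialDeriv i U x‖ := by
        refine Finset.sum_congr rfl fun i _ => ?_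
        rw [norm_smul, Real.norm_eq_abs]
    _ ≤ Real.sqrt (∑ i, |(u x) i| ^ 2) * Real.sqrt (∑ i, ‖Torus.partialDeriv i U x‖ ^ 2) :=
        Real.sum_mul_le_sqrt_mul_sqrt _ _ _
    _ = ‖u x‖ * Real.sqrt (∑ i, ‖Torus.partialDeriv i U x‖ ^ 2) := by
        rw [EuclideanSpace.norm_eq]
        simp only [Real.norm_eq_abs]

/-- **The per-term `L²` bound against `‖v‖_∞`**: for words `α ≠ []`, `β` with `|α| + |β| = n` and a
smooth `v` with `‖v‖ ≤ A`, `∫ ‖∂^α v‖² ‖∂^β ∂ⱼv‖² ≤ 2 C A² E_{n+1}(v)` (the bilinear Gagliardo–Nirenberg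
bound at order `n + 1` for the pair `v, v`, `k = |α| ≥ 1`, `∂^β ∂ⱼ v = ∂^{β++[j]} v`).
[cite: DoeringGibbon1995, Ch. 6 Exercise 3 (E6.8); Appendix A (A.0.19)–(A.0.21)] (every order; ours as bookkeeping) -/
theorem integral_normSq_wordDeriv_mul_le_sup (hv : IsSmooth v) {A : ℝ} (hA : ∀ x, ‖v x‖ ≤ A) {n : ℕ} {C : ℝ}
    (hC : ∀ k, k ≤ n + 1 → ∀ (f₁ f₂ : UnitAddTorus d → EuclideanSpace ℝ d), IsSmooth f₁ → IsSmooth f₂ → ∀ A : ℝ,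
      (∀ x, ‖f₁ x‖ ≤ A) → (∀ x, ‖f₂ x‖ ≤ A) →
        ∫ x, wordGradSq k f₁ x * wordGradSq (n + 1 - k) f₂ x ≤ C * A ^ 2 * (wordEnergy (n + 1) f₁ + wordEnergy (n + 1) f₂))
    {α β : List d} (hαβ : α.length + β.length = n) (j : d) :
    ∫ x, ‖wordDeriv α v x‖ ^ 2 * ‖wordDeriv β (Torus.partialDeriv j v) x‖ ^ 2 ≤ 2 * C * A ^ 2 * wordEnergy (n + 1) v := by
  have hk : α.length ≤ n + 1 := by omega
  have hβ : (β ++ [j]).length = n + 1 - α.length := by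
    rw [List.length_append, List.length_singleton]; omega
  have h1 := hC α.length hk v v hv hv A hA hA
  have hvj : IsSmooth (Torus.partialDeriv j v) := hv.partialDeriv j
  have h2 : ∫ x, ‖wordDeriv α v x‖ ^ 2 * ‖wordDeriv β (Torus.partialDeriv j v) x‖ ^ 2 ≤
      ∫ x, wordGradSq α.length v x * wordGradSq (n + 1 - α.length) v x := by
    refine integral_mono ?_ (((continuous_wordGradSq hv _).mul (continuous_wordGradSq hv _)).integrable_unitAddTorus)
      fun x => ?_
    · exact ((((isSmooth_wordDeriv hv _).continuous.norm).pow 2).mul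
        (((isSmooth_wordDeriv hvj _).continuous.norm).pow 2)).integrable_unitAddTorus
    · have e1 : wordDeriv β (Torus.partialDeriv j v) = wordDeriv (β ++ [j]) v := (wordDeriv_concat β j v).symm
      rw [e1, ← hβ]
      exact mul_le_mul (norm_sq_wordDeriv_list_le_wordGradSq _ _ x) (norm_sq_wordDeriv_list_le_wordGradSq _ _ x)
        (sq_nonneg _) (wordGradSq_nonneg _ _ _)
  refine h2.trans (h1.trans (le_of_eq ?_))
  ring

omit [Fintype d] in
/-- A lower commutator unpacked as a finite sum over `Fin (lowerSplits w).length`. [folklore] -/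
private theorem lowCommS_eq_sum_fin' {F : Type*} [NormedAddCommGroup F] [NormedSpace ℝ F] (w : List d)
    (a : UnitAddTorus d → ℝ) (U : UnitAddTorus d → F) (x : UnitAddTorus d) :
    lowCommS w a U x = ∑ k : Fin (lowerSplits w).length,
      wordDeriv ((lowerSplits w).get k).1 a x • wordDeriv ((lowerSplits w).get k).2 U x := by
  unfold lowCommS
  rw [list_map_sum_eq_sum_fin, Finset.sum_apply]

/-- **The per-term pairing bound against `‖v‖_∞`**: for `α`, `β` with `|α| + |β| = n` and a smooth
test field `W`, `|∫ ⟪∂^α vⱼ • ∂^β ∂ⱼv, W⟫| ≤ (2C)^{1/2} A E_{n+1}(v)^{1/2} (∫‖W‖²)^{1/2}`.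
[cite: DoeringGibbon1995, Ch. 6 Exercise 3 (E6.8)] (every order; ours as bookkeeping) -/
theorem abs_integral_inner_term_le_sup (hv : IsSmooth v) {A : ℝ} (hA0 : 0 ≤ A) (hA : ∀ x, ‖v x‖ ≤ A)
    {n : ℕ} {C : ℝ} (hC0 : 0 ≤ C)
    (hC : ∀ k, k ≤ n + 1 → ∀ (f₁ f₂ : UnitAddTorus d → EuclideanSpace ℝ d), IsSmooth f₁ → IsSmooth f₂ → ∀ A : ℝ,
      (∀ x, ‖f₁ x‖ ≤ A) → (∀ x, ‖f₂ x‖ ≤ A) →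
        ∫ x, wordGradSq k f₁ x * wordGradSq (n + 1 - k) f₂ x ≤ C * A ^ 2 * (wordEnergy (n + 1) f₁ + wordEnergy (n + 1) f₂))
    {α β : List d} (hαβ : α.length + β.length = n) (j : d) {W : UnitAddTorus d → EuclideanSpace ℝ d}
    (hW : IsSmooth W) :
    |∫ x, ⟪wordDeriv α (fun y => v y j) x • wordDeriv β (Torus.partialDeriv j v) x, W x⟫| ≤
      Real.sqrt (2 * C) * A * Real.sqrt (wordEnergy (n + 1) v) * Real.sqrt (∫ x, ‖W x‖ ^ 2) := by
  have hvj : IsSmooth (fun y => v y j) := hv.apply j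
  have hα_s : IsSmooth (wordDeriv α (fun y => v y j)) := isSmooth_wordDeriv hvj α
  have hβ_s : IsSmooth (wordDeriv β (Torus.partialDeriv j v)) := isSmooth_wordDeriv (hv.partialDeriv j) β
  have hT : IsSmooth (fun x => wordDeriv α (fun y => v y j) x • wordDeriv β (Torus.partialDeriv j v) x) :=
    hα_s.smul' hβ_s
  have h1 := abs_integral_inner_le_sqrt_mul_sqrt_of_isSmooth hT hW
  refine h1.trans (mul_le_mul_of_nonneg_right ?_ (Real.sqrt_nonneg _))
  -- `∫ ‖T‖² ≤ ∫ ‖∂^α v‖² ‖∂^β ∂ⱼ v‖² ≤ 2 C A² E_{n+1}(v)`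
  have hαv : IsSmooth (wordDeriv α v) := isSmooth_wordDeriv hv α
  have h3 : ∫ x, ‖wordDeriv α (fun y => v y j) x • wordDeriv β (Torus.partialDeriv j v) x‖ ^ 2 ≤
      2 * C * A ^ 2 * wordEnergy (n + 1) v := by
    have hpt : ∀ x, ‖wordDeriv α (fun y => v y j) x • wordDeriv β (Torus.partialDeriv j v) x‖ ^ 2 ≤
        ‖wordDeriv α v x‖ ^ 2 * ‖wordDeriv β (Torus.partialDeriv j v) x‖ ^ 2 := by
      intro x
      rw [norm_smul, mul_pow, Real.norm_eq_abs]
      refine mul_le_mul_of_nonneg_right (pow_le_pow_left₀ (abs_nonneg _) ?_ 2) (sq_nonneg _)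
      rw [← wordDeriv_apply_coord hv j α x, ← Real.norm_eq_abs]
      exact PiLp.norm_apply_le (wordDeriv α v x) j
    have hi : Integrable (fun x => ‖wordDeriv α v x‖ ^ 2 * ‖wordDeriv β (Torus.partialDeriv j v) x‖ ^ 2) volume :=
      ((hαv.continuous.norm.pow 2).mul (hβ_s.continuous.norm.pow 2)).integrable_unitAddTorus
    exact (integral_mono ((hT.continuous.norm.pow 2).integrable_unitAddTorus) hi hpt).trans
      (integral_normSq_wordDeriv_mul_le_sup hv hA hC hαβ j)
  calc Real.sqrt (∫ x, ‖wordDeriv α (fun y => v y j) x • wordDeriv β (Torus.partialDeriv j v) x‖ ^ 2)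
      ≤ Real.sqrt (2 * C * A ^ 2 * wordEnergy (n + 1) v) := Real.sqrt_le_sqrt h3
    _ = Real.sqrt (2 * C) * A * Real.sqrt (wordEnergy (n + 1) v) := by
        rw [show 2 * C * A ^ 2 * wordEnergy (n + 1) v = (2 * C) * (A ^ 2 * wordEnergy (n + 1) v) by ring,
          Real.sqrt_mul (by positivity), Real.sqrt_mul (sq_nonneg A), Real.sqrt_sq hA0, mul_assoc]

/-- **The top (transport) term against `‖v‖_∞`**: `|∫ ⟪(v·∇)∂^w v, W⟫| ≤ A (∑ᵢ∫‖∂ᵢ∂^w v‖²)^{1/2} (∫‖W‖²)^{1/2}`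
for `‖v‖ ≤ A`. [cite: DoeringGibbon1995, Ch. 6 Exercise 3 (E6.8)] (bookkeeping) -/
theorem abs_integral_inner_convect_wordDeriv_le_sup (hv : IsSmooth v) {A : ℝ} (hA0 : 0 ≤ A) (hA : ∀ x, ‖v x‖ ≤ A)
    (w : List d) {W : UnitAddTorus d → EuclideanSpace ℝ d} (hW : IsSmooth W) :
    |∫ x, ⟪Torus.convect v (wordDeriv w v) x, W x⟫| ≤
      A * Real.sqrt (∑ i, ∫ x, ‖Torus.partialDeriv i (wordDeriv w v) x‖ ^ 2) * Real.sqrt (∫ x, ‖W x‖ ^ 2) := by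
  have hU : IsSmooth (wordDeriv w v) := isSmooth_wordDeriv hv w
  set g : UnitAddTorus d → ℝ := fun x => Real.sqrt (∑ i, ‖Torus.partialDeriv i (wordDeriv w v) x‖ ^ 2) with hg_def
  have hθs : IsSmooth (fun x => ∑ i, ‖Torus.partialDeriv i (wordDeriv w v) x‖ ^ 2) := by
    have h : ∀ m, IsSmooth (fun y => ‖Torus.partialDeriv m (wordDeriv w v) y‖ ^ 2) := fun m => (hU.partialDeriv m).norm_sq
    unfold IsSmooth at h ⊢
    exact ContDiff.sum fun m _ => h m
  have hgc : Continuous g := hθs.continuous.sqrt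
  have hg0 : ∀ x, 0 ≤ g x := fun x => Real.sqrt_nonneg _
  have hWc : Continuous fun x => ‖W x‖ := hW.continuous.norm
  have h1 : |∫ x, ⟪Torus.convect v (wordDeriv w v) x, W x⟫| ≤ ∫ x, (A * g x) * ‖W x‖ := by
    refine (abs_integral_le_integral_abs (μ := volume)).trans (integral_mono_of_nonneg (ae_of_all _ fun x => abs_nonneg _)
      (((continuous_const.mul hgc).mul hWc).integrable_unitAddTorus) (ae_of_all _ fun x => ?_))
    calc |⟪Torus.convect v (wordDeriv w v) x, W x⟫| ≤ ‖Torus.convect v (wordDeriv w v) x‖ * ‖W x‖ :=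
          abs_real_inner_le_norm _ _
      _ ≤ (‖v x‖ * g x) * ‖W x‖ := mul_le_mul_of_nonneg_right (norm_convect_le_norm_mul_sqrt' hU x) (norm_nonneg _)
      _ ≤ (A * g x) * ‖W x‖ := mul_le_mul_of_nonneg_right (mul_le_mul_of_nonneg_right (hA x) (hg0 x)) (norm_nonneg _)
  have h2 : ∫ x, (A * g x) * ‖W x‖ = A * ∫ x, g x * ‖W x‖ := by
    rw [← integral_const_mul]; congr 1; funext x; ring
  have h3 : ∫ x, g x * ‖W x‖ ≤ Real.sqrt (∫ x, g x ^ 2) * Real.sqrt (∫ x, ‖W x‖ ^ 2) :=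
    integral_mul_le_sqrt_mul_sqrt' hgc hWc hg0 fun x => norm_nonneg _
  have h4 : ∫ x, g x ^ 2 = ∑ i, ∫ x, ‖Torus.partialDeriv i (wordDeriv w v) x‖ ^ 2 := by
    have hint : ∀ i, Integrable (fun x => ‖Torus.partialDeriv i (wordDeriv w v) x‖ ^ 2) volume := fun i =>
      ((hU.partialDeriv i).continuous.norm.pow 2).integrable_unitAddTorus
    rw [← integral_finsetSum _ fun i _ => hint i]
    exact integral_congr_ae (ae_of_all _ fun x => by
      simp only [hg_def]; rw [Real.sq_sqrt (Finset.sum_nonneg fun i _ => sq_nonneg _)])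
  rw [h4] at h3
  calc |∫ x, ⟪Torus.convect v (wordDeriv w v) x, W x⟫| ≤ ∫ x, (A * g x) * ‖W x‖ := h1
    _ = A * ∫ x, g x * ‖W x‖ := h2
    _ ≤ A * (Real.sqrt (∑ i, ∫ x, ‖Torus.partialDeriv i (wordDeriv w v) x‖ ^ 2) * Real.sqrt (∫ x, ‖W x‖ ^ 2)) :=
        mul_le_mul_of_nonneg_left h3 hA0
    _ = A * Real.sqrt (∑ i, ∫ x, ‖Torus.partialDeriv i (wordDeriv w v) x‖ ^ 2) * Real.sqrt (∫ x, ‖W x‖ ^ 2) := by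
        ring

/-- **Doering–Gibbon's `‖u‖_∞` estimate of the nonlinear term at every rung** ((E6.8):
`|∫ Dᴺu · Dᴺ[(u·∇)u]| ≤ c_N H_N^{1/2} H_{N+1}^{1/2} ‖u‖_∞`, `N = n + 1`): for every `n` there is
`c = c(card d, n) ≥ 0` such that for every smooth `v : T^d → ℝ^d` and every `A` with `‖v(x)‖ ≤ A`
for all `x`, `|NL_{n+1}(v)| ≤ c A E_{n+1}(v)^{1/2} E_{n+2}(v)^{1/2}` (`NL = ladderNonlinear`; no
divergence condition). [cite: DoeringGibbon1995, Ch. 6 Exercise 3 (E6.8); §6.5 Table 6.1] -/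
theorem exists_abs_ladderNonlinear_le_sup (d : Type*) [Fintype d] [DecidableEq d] (n : ℕ) :
    ∃ c : ℝ, 0 ≤ c ∧ ∀ (v : UnitAddTorus d → EuclideanSpace ℝ d), IsSmooth v → ∀ A : ℝ,
      (∀ x, ‖v x‖ ≤ A) →
        |ladderNonlinear (n + 1) v| ≤ c * A * Real.sqrt (wordEnergy (n + 1) v) * Real.sqrt (wordEnergy (n + 2) v) := by
  obtain ⟨C, hC0, hC⟩ := exists_uniform_bilinear' d (EuclideanSpace ℝ d) (n + 1)
  set K : ℝ := Real.sqrt (2 * C) with hK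
  have hK0 : 0 ≤ K := Real.sqrt_nonneg _
  refine ⟨∑ w : Fin n → d, ∑ _i : d, (1 + ∑ _j : d, ((lowerSplits (List.ofFn w)).length : ℝ) * K),
    by positivity, fun v hv A hA => ?_⟩
  have hA0 : 0 ≤ A := (norm_nonneg _).trans (hA 0)
  set S1 : ℝ := Real.sqrt (wordEnergy (n + 1) v) with hS1
  set S2 : ℝ := Real.sqrt (wordEnergy (n + 2) v) with hS2
  have hS10 : 0 ≤ S1 := Real.sqrt_nonneg _
  have hS20 : 0 ≤ S2 := Real.sqrt_nonneg _
  -- reindex the outer letter: `NL_{n+1}(v) = ∑_w ∑ᵢ ∫ ⟪∂ᵢ∂^w G, ∂ᵢ∂^w v⟫`, `G = (v·∇)v`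
  have hre : ladderNonlinear (n + 1) v = ∑ w : Fin n → d, ∑ i : d,
      ∫ x, ⟪Torus.partialDeriv i (wordDeriv (List.ofFn w) (Torus.convect v v)) x,
        Torus.partialDeriv i (wordDeriv (List.ofFn w) v) x⟫ := by
    unfold ladderNonlinear
    rw [← (Fin.consEquiv fun _ : Fin (n + 1) => d).sum_comp, Fintype.sum_prod_type, Finset.sum_comm]
    refine Finset.sum_congr rfl fun w _ => Finset.sum_congr rfl fun i _ => ?_
    have : List.ofFn ((Fin.consEquiv fun _ : Fin (n + 1) => d) (i, w)) = i :: List.ofFn w := by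
      simp [Fin.consEquiv]
    rw [this, wordDeriv_cons, wordDeriv_cons]
  rw [hre]
  -- word by word, letter by letter
  have hterm : ∀ (w : Fin n → d) (i : d),
      |∫ x, ⟪Torus.partialDeriv i (wordDeriv (List.ofFn w) (Torus.convect v v)) x,
        Torus.partialDeriv i (wordDeriv (List.ofFn w) v) x⟫| ≤
        (1 + ∑ _j : d, ((lowerSplits (List.ofFn w)).length : ℝ) * K) * A * S1 * S2 := by
    intro w i
    set W' := List.ofFn w with hW'
    have hW'len : W'.length = n := by simp [hW']
    have hG : IsSmooth (Torus.convect v v) := hv.convect hv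
    have hGw : IsSmooth (wordDeriv W' (Torus.convect v v)) := isSmooth_wordDeriv hG W'
    have hvw : IsSmooth (wordDeriv W' v) := isSmooth_wordDeriv hv W'
    set W : UnitAddTorus d → EuclideanSpace ℝ d := Torus.partialDeriv i (Torus.partialDeriv i (wordDeriv W' v)) with hWdef
    have hWs : IsSmooth W := (hvw.partialDeriv i).partialDeriv i
    -- integrate by parts once
    rw [integral_inner_partialDeriv_eq_neg hGw (hvw.partialDeriv i) i, abs_neg]
    -- `∫ ‖W‖² ≤ E_{n+2}(v)`, `∑ᵢ ∫ ‖∂ᵢ∂^w v‖² ≤ E_{n+1}(v)`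
    have hW2 : ∫ x, ‖W x‖ ^ 2 ≤ wordEnergy (n + 2) v := by
      have h := integral_norm_sq_wordDeriv_le_wordEnergy (Fin.cons i (Fin.cons i w) : Fin (n + 2) → d) v
      have e : List.ofFn (Fin.cons i (Fin.cons i w) : Fin (n + 2) → d) = i :: i :: W' := by
        rw [List.ofFn_succ, List.ofFn_succ]
        simp [hW']
      rw [e, wordDeriv_cons, wordDeriv_cons] at h
      exact h
    have hsqW : Real.sqrt (∫ x, ‖W x‖ ^ 2) ≤ S2 := Real.sqrt_le_sqrt hW2
    have hD1 : ∑ i', ∫ x, ‖Torus.partialDeriv i' (wordDeriv W' v) x‖ ^ 2 ≤ wordEnergy (n + 1) v :=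
      sum_integral_norm_sq_partialDeriv_wordDeriv_le w v
    have hsqD : Real.sqrt (∑ i', ∫ x, ‖Torus.partialDeriv i' (wordDeriv W' v) x‖ ^ 2) ≤ S1 := Real.sqrt_le_sqrt hD1
    -- Leibniz
    have hint_terms : ∀ (j : d) (k : Fin (lowerSplits W').length), Integrable (fun x =>
        ⟪wordDeriv ((lowerSplits W').get k).1 (fun y => v y j) x •
          wordDeriv ((lowerSplits W').get k).2 (Torus.partialDeriv j v) x, W x⟫) volume := fun j k =>
      (((isSmooth_wordDeriv (hv.apply j) _).smul' (isSmooth_wordDeriv (hv.partialDeriv j) _)).inner hWs).integrable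
    have hdec : ∫ x, ⟪wordDeriv W' (Torus.convect v v) x, W x⟫ =
        (∫ x, ⟪Torus.convect v (wordDeriv W' v) x, W x⟫) +
          ∑ j, ∑ k : Fin (lowerSplits W').length,
            ∫ x, ⟪wordDeriv ((lowerSplits W').get k).1 (fun y => v y j) x •
              wordDeriv ((lowerSplits W').get k).2 (Torus.partialDeriv j v) x, W x⟫ := by
      simp_rw [wordDeriv_convect_apply hv W', inner_add_left, lowCommS_eq_sum_fin', sum_inner]
      rw [integral_add ((hv.convect hvw).inner hWs).integrable
        (integrable_finsetSum _ fun j _ => integrable_finsetSum _ fun k _ => hint_terms j k),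
        integral_finsetSum _ fun j _ => integrable_finsetSum _ fun k _ => hint_terms j k]
      congr 1
      exact Finset.sum_congr rfl fun j _ => integral_finsetSum _ fun k _ => hint_terms j k
    rw [hdec]
    -- the top term
    have htop : |∫ x, ⟪Torus.convect v (wordDeriv W' v) x, W x⟫| ≤ A * S1 * S2 := by
      refine (abs_integral_inner_convect_wordDeriv_le_sup hv hA0 hA W' hWs).trans ?_
      exact mul_le_mul (mul_le_mul_of_nonneg_left hsqD hA0) hsqW (Real.sqrt_nonneg _) (by positivity)
    -- the commutator terms
    have hlow : ∀ (j : d) (k : Fin (lowerSplits W').length),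
        |∫ x, ⟪wordDeriv ((lowerSplits W').get k).1 (fun y => v y j) x •
            wordDeriv ((lowerSplits W').get k).2 (Torus.partialDeriv j v) x, W x⟫| ≤ K * A * S1 * S2 := by
      intro j k
      obtain ⟨_, hlen⟩ := mem_lowerSplits (List.get_mem (lowerSplits W') k)
      rw [hW'len] at hlen
      refine (abs_integral_inner_term_le_sup hv hA0 hA hC0 hC hlen j hWs).trans ?_
      exact mul_le_mul_of_nonneg_left hsqW (by positivity)
    calc |(∫ x, ⟪Torus.convect v (wordDeriv W' v) x, W x⟫) +
          ∑ j, ∑ k : Fin (lowerSplits W').length,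
            ∫ x, ⟪wordDeriv ((lowerSplits W').get k).1 (fun y => v y j) x •
              wordDeriv ((lowerSplits W').get k).2 (Torus.partialDeriv j v) x, W x⟫|
        ≤ |∫ x, ⟪Torus.convect v (wordDeriv W' v) x, W x⟫| +
            ∑ j, ∑ k : Fin (lowerSplits W').length,
              |∫ x, ⟪wordDeriv ((lowerSplits W').get k).1 (fun y => v y j) x •
                wordDeriv ((lowerSplits W').get k).2 (Torus.partialDeriv j v) x, W x⟫| := by
          refine (abs_add_le _ _).trans (add_le_add le_rfl ?_)
          exact (Finset.abs_sum_le_sum_abs _ _).trans (Finset.sum_le_sum fun j _ => Finset.abs_sum_le_sum_abs _ _)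
      _ ≤ A * S1 * S2 + ∑ j : d, ∑ _k : Fin (lowerSplits W').length, K * A * S1 * S2 :=
          add_le_add htop (Finset.sum_le_sum fun j _ => Finset.sum_le_sum fun k _ => hlow j k)
      _ = (1 + ∑ _j : d, ((lowerSplits W').length : ℝ) * K) * A * S1 * S2 := by
          rw [Finset.sum_congr rfl fun j _ => by rw [Finset.sum_const, Finset.card_univ, Fintype.card_fin, nsmul_eq_mul]]
          rw [Finset.sum_const, Finset.card_univ, nsmul_eq_mul, Finset.sum_const, Finset.card_univ, nsmul_eq_mul]
          ring
  calc |∑ w : Fin n → d, ∑ i : d, ∫ x, ⟪Torus.partialDeriv i (wordDeriv (List.ofFn w) (Torus.convect v v)) x,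
          Torus.partialDeriv i (wordDeriv (List.ofFn w) v) x⟫|
      ≤ ∑ w : Fin n → d, ∑ i : d, |∫ x, ⟪Torus.partialDeriv i (wordDeriv (List.ofFn w) (Torus.convect v v)) x,
          Torus.partialDeriv i (wordDeriv (List.ofFn w) v) x⟫| :=
        (Finset.abs_sum_le_sum_abs _ _).trans (Finset.sum_le_sum fun w _ => Finset.abs_sum_le_sum_abs _ _)
    _ ≤ ∑ w : Fin n → d, ∑ _i : d, (1 + ∑ _j : d, ((lowerSplits (List.ofFn w)).length : ℝ) * K) * A * S1 * S2 :=
        Finset.sum_le_sum fun w _ => Finset.sum_le_sum fun i _ => hterm w i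
    _ = (∑ w : Fin n → d, ∑ _i : d, (1 + ∑ _j : d, ((lowerSplits (List.ofFn w)).length : ℝ) * K)) * A * S1 * S2 := by
        rw [Finset.sum_mul, Finset.sum_mul, Finset.sum_mul]
        refine Finset.sum_congr rfl fun w _ => ?_
        rw [Finset.sum_mul, Finset.sum_mul, Finset.sum_mul]


/-! ## The `‖u‖_∞` ladder along classical solutions (E6.9) -/

/-- **The `H_N`-ladder controlled by `‖u‖_∞`, every rung, any dimension, any `ν`** ((E6.8) inserted
in the `H_N`-balance (6.2.12)): for every `n` there is `c = c(card d, n) ≥ 0` such that along every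
classical solution on `T^d × [a, b]`, `a < b`, at every `t ∈ [a, b]` and for every `A` with
`‖u(t, x)‖ ≤ A` for all `x`,
`d/dt ½E_{n+1}(u(t)) ≤ −ν E_{n+2}(u(t)) + c A E_{n+1}(u(t))^{1/2} E_{n+2}(u(t))^{1/2} + E_{n+1}(u(t))^{1/2} E_{n+1}(f(t))^{1/2}`
(one-sided derivative within `[a, b]`). [cite: DoeringGibbon1995, Ch. 6 Exercise 3 (E6.8)–(E6.9); §6.2 (6.2.12), (6.2.26)] -/
theorem exists_ladder_inequality_sup (d : Type*) [Fintype d] [DecidableEq d] (n : ℕ) :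
    ∃ c : ℝ, 0 ≤ c ∧ ∀ {a b ν : ℝ} {f u : ℝ → UnitAddTorus d → EuclideanSpace ℝ d} {p : ℝ → UnitAddTorus d → ℝ},
      Torus.IsClassicalNSSolutionOn (Icc a b) ν f u p → a < b → ∀ {t : ℝ}, t ∈ Icc a b → ∀ A : ℝ,
        (∀ x, ‖u t x‖ ≤ A) →
        derivWithin (fun s => 2⁻¹ * wordEnergy (n + 1) (u s)) (Icc a b) t ≤
          -ν * wordEnergy (n + 2) (u t) +
            c * A * Real.sqrt (wordEnergy (n + 1) (u t)) * Real.sqrt (wordEnergy (n + 2) (u t)) +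
            Real.sqrt (wordEnergy (n + 1) (u t)) * Real.sqrt (wordEnergy (n + 1) (f t)) := by
  obtain ⟨c, hc0, hc⟩ := exists_abs_ladderNonlinear_le_sup d n
  refine ⟨c, hc0, fun {a b ν f u p} h hab t ht A hA => ?_⟩
  have hut : IsSmooth (u t) := h.smooth_velocity.isSmooth_slice ht
  -- the forcing slice is smooth (read off the momentum equation)
  have hft : IsSmooth (f t) := by
    have hfun : f t = fun x => Torus.timeDerivWithin (Icc a b) u t x +
        Torus.convect (u t) (u t) x - ν • Torus.laplacian (u t) x + Torus.gradient (p t) x := by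
      funext x
      rw [h.momentum t ht x]
      abel
    rw [hfun]
    exact (((h.smooth_velocity.isSmooth_timeDerivWithin (uniqueDiffOn_Icc hab) ht).add (hut.convect hut)).sub
      (hut.laplacian.smul ν)).add (h.smooth_pressure.isSmooth_slice ht).gradient
  rw [(h.hasDerivWithinAt_half_wordEnergy hab (n + 1) ht).derivWithin (uniqueDiffOn_Icc hab t ht),
    show n + 1 + 1 = n + 2 by ring]
  have h1 := hc (u t) hut A hA
  have h2 := abs_wordForcing_le hft hut (n + 1)
  linarith [neg_abs_le (ladderNonlinear (n + 1) (u t)), le_abs_self (wordForcing (n + 1) (f t) (u t))]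

/-- **(E6.9), `H_N`-form**: for `ν > 0`, after Young's inequality,
`d/dt ½E_{n+1}(u(t)) ≤ −(ν/2) E_{n+2}(u(t)) + (c²/(2ν)) A² E_{n+1}(u(t)) + E_{n+1}(u(t))^{1/2} E_{n+1}(f(t))^{1/2}`
("the alternative full ladder … `c_N ν⁻¹ ‖u‖²_∞`"). [cite: DoeringGibbon1995, Ch. 6 Exercise 3 (E6.9)] -/
theorem exists_ladder_inequality_sup_sq (d : Type*) [Fintype d] [DecidableEq d] (n : ℕ) :
    ∃ c : ℝ, 0 ≤ c ∧ ∀ {a b ν : ℝ} {f u : ℝ → UnitAddTorus d → EuclideanSpace ℝ d} {p : ℝ → UnitAddTorus d → ℝ},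
      Torus.IsClassicalNSSolutionOn (Icc a b) ν f u p → a < b → 0 < ν → ∀ {t : ℝ}, t ∈ Icc a b → ∀ A : ℝ,
        (∀ x, ‖u t x‖ ≤ A) →
        derivWithin (fun s => 2⁻¹ * wordEnergy (n + 1) (u s)) (Icc a b) t ≤
          -(ν / 2) * wordEnergy (n + 2) (u t) + c ^ 2 / (2 * ν) * A ^ 2 * wordEnergy (n + 1) (u t) +
            Real.sqrt (wordEnergy (n + 1) (u t)) * Real.sqrt (wordEnergy (n + 1) (f t)) := by
  obtain ⟨c, hc0, hc⟩ := exists_ladder_inequality_sup d n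
  refine ⟨c, hc0, fun {a b ν f u p} h hab hν t ht A hA => ?_⟩
  have h1 := hc h hab ht A hA
  have hE1 : 0 ≤ wordEnergy (n + 1) (u t) := wordEnergy_nonneg _ _
  have hE2 : 0 ≤ wordEnergy (n + 2) (u t) := wordEnergy_nonneg _ _
  -- Young: `c A √E₁ √E₂ ≤ (ν/2) E₂ + (c²A²/(2ν)) E₁`
  have hY : c * A * Real.sqrt (wordEnergy (n + 1) (u t)) * Real.sqrt (wordEnergy (n + 2) (u t)) ≤
      ν / 2 * wordEnergy (n + 2) (u t) + c ^ 2 / (2 * ν) * A ^ 2 * wordEnergy (n + 1) (u t) := by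
    set ρ₁ : ℝ := Real.sqrt (wordEnergy (n + 1) (u t)) with hρ₁
    set ρ₂ : ℝ := Real.sqrt (wordEnergy (n + 2) (u t)) with hρ₂
    have e1 : ρ₁ ^ 2 = wordEnergy (n + 1) (u t) := Real.sq_sqrt hE1
    have e2 : ρ₂ ^ 2 = wordEnergy (n + 2) (u t) := Real.sq_sqrt hE2
    rw [← e1, ← e2]
    have e : ν / 2 * ρ₂ ^ 2 + c ^ 2 / (2 * ν) * A ^ 2 * ρ₁ ^ 2 - c * A * ρ₁ * ρ₂ =
        (ν * ρ₂ - c * A * ρ₁) ^ 2 / (2 * ν) := by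
      field_simp
      ring
    have : 0 ≤ (ν * ρ₂ - c * A * ρ₁) ^ 2 / (2 * ν) := by positivity
    linarith
  linarith

/-- **Every rung is controlled by `∫ ‖u‖²_∞`** (Grönwall on (E6.9), unforced, `ν > 0`): with the
constant `c` of `exists_ladder_inequality_sup`, for every classical solution of the unforced system on
`T^d × [a, b]`, `a < b`, every continuous `A ≥ 0` on `[a, b]` with `‖u(s, x)‖ ≤ A(s)`, and every
`t ∈ [a, b]`: `E_{n+1}(u(t)) ≤ E_{n+1}(u(a)) · exp((c²/ν) ∫ₐᵗ A(s)² ds)` — all the `H_N` stay bounded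
as long as `∫ ‖u‖²_∞ dt` does. [cite: DoeringGibbon1995, Ch. 6 Exercise 3 (E6.9); §7.3.1]
(every rung; the Grönwall step is ours as bookkeeping) -/
theorem exists_wordEnergy_le_mul_exp_integral_sup (d : Type*) [Fintype d] [DecidableEq d] (n : ℕ) :
    ∃ c : ℝ, 0 ≤ c ∧ ∀ {a b ν : ℝ} {u : ℝ → UnitAddTorus d → EuclideanSpace ℝ d} {p : ℝ → UnitAddTorus d → ℝ},
      Torus.IsClassicalNSSolutionOn (Icc a b) ν (fun _ _ => 0) u p → a < b → 0 < ν → ∀ {A : ℝ → ℝ},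
        ContinuousOn A (Icc a b) → (∀ s ∈ Icc a b, ∀ x, ‖u s x‖ ≤ A s) →
        ∀ {t : ℝ}, t ∈ Icc a b →
          wordEnergy (n + 1) (u t) ≤ wordEnergy (n + 1) (u a) * Real.exp (c ^ 2 / ν * ∫ s in a..t, A s ^ 2) := by
  obtain ⟨c, hc0, hc⟩ := exists_ladder_inequality_sup_sq d n
  refine ⟨c, hc0, fun {a b ν u p} h hab hν A hAc hA t ht => ?_⟩
  set F : ℝ → ℝ := fun r => 2⁻¹ * wordEnergy (n + 1) (u r) with hF
  have hder : ∀ s ∈ Icc a b, HasDerivWithinAt F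
      (-ν * wordEnergy (n + 1 + 1) (u s) - ladderNonlinear (n + 1) (u s) +
        wordForcing (n + 1) ((fun _ _ => (0 : EuclideanSpace ℝ d)) s) (u s)) (Icc a b) s :=
    fun s hs => h.hasDerivWithinAt_half_wordEnergy hab (n + 1) hs
  have hle : ∀ s ∈ Icc a b,
      -ν * wordEnergy (n + 1 + 1) (u s) - ladderNonlinear (n + 1) (u s) +
        wordForcing (n + 1) ((fun _ _ => (0 : EuclideanSpace ℝ d)) s) (u s) ≤ (c ^ 2 / ν * A s ^ 2) * F s := by
    intro s hs
    have h1 := hc h hab hν hs (A s) (hA s hs)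
    rw [(h.hasDerivWithinAt_half_wordEnergy hab (n + 1) hs).derivWithin (uniqueDiffOn_Icc hab s hs)] at h1
    have hΦ0 : wordEnergy (n + 1) (fun _ : UnitAddTorus d => (0 : EuclideanSpace ℝ d)) = 0 := by
      unfold wordEnergy
      refine Finset.sum_eq_zero fun w _ => ?_
      rw [wordDeriv_zero]
      simp
    simp only [hΦ0, Real.sqrt_zero, mul_zero, add_zero] at h1
    have hE2 : 0 ≤ wordEnergy (n + 2) (u s) := wordEnergy_nonneg _ _
    have e : (c ^ 2 / ν * A s ^ 2) * F s = c ^ 2 / (2 * ν) * A s ^ 2 * wordEnergy (n + 1) (u s) := by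
      rw [hF]; field_simp
    rw [e]
    have : -(ν / 2) * wordEnergy (n + 2) (u s) ≤ 0 := by nlinarith
    linarith
  have hk : ContinuousOn (fun s => c ^ 2 / ν * A s ^ 2) (Icc a b) := continuousOn_const.mul (hAc.pow 2)
  have hmain := le_mul_exp_integral_of_hasDerivWithinAt_le_mul hab hder hk hle ht
  rw [intervalIntegral.integral_const_mul] at hmain
  have e : ∀ r, wordEnergy (n + 1) (u r) = 2 * F r := fun r => by rw [hF]; ring
  rw [e t, e a, mul_assoc]
  exact mul_le_mul_of_nonneg_left hmain (by norm_num)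

/-- **(E6.9) for `F_N`, the "second `F_N` ladder"** of Doering–Gibbon's Table 6.1: for a
TIME-INDEPENDENT smooth forcing `f` with the spectral cutoff `Φ_{n+2} ≤ Λ Φ_{n+1}` (`Λ = λ_f⁻² ≥ 0`,
`λ₀⁻² = Λ + 1` on the unit torus) and `ν > 0`, along every classical solution on `T^d × [a, b]`, at
every `t ∈ [a, b]` with `‖u(t, x)‖ ≤ A` for all `x`,
`d/dt ½F_{n+1} ≤ −(ν/2) F_{n+2} + (c²(2ν)⁻¹ A² + (ν/2)(Λ+1)) F_{n+1}`, `F_N = ladderF ν N f (u t)`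
(`√E_{n+1}√Φ_{n+1} ≤ (ν/2)F_{n+1}`, `(ν/2)ν⁻²Φ_{n+2} ≤ (ν/2)ΛF_{n+1}`).
[cite: DoeringGibbon1995, Ch. 6 Exercise 3 (E6.9); §6.5 Table 6.1] -/
theorem exists_ladderF_inequality_sup (d : Type*) [Fintype d] [DecidableEq d] (n : ℕ) :
    ∃ c : ℝ, 0 ≤ c ∧ ∀ {a b ν : ℝ} {f : UnitAddTorus d → EuclideanSpace ℝ d} {u : ℝ → UnitAddTorus d → EuclideanSpace ℝ d}
      {p : ℝ → UnitAddTorus d → ℝ}, Torus.IsClassicalNSSolutionOn (Icc a b) ν (fun _ => f) u p → a < b → 0 < ν →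
      ∀ {Λ : ℝ}, 0 ≤ Λ → wordEnergy (n + 2) f ≤ Λ * wordEnergy (n + 1) f → ∀ {t : ℝ}, t ∈ Icc a b → ∀ A : ℝ,
        (∀ x, ‖u t x‖ ≤ A) →
        derivWithin (fun s => 2⁻¹ * ladderF ν (n + 1) f (u s)) (Icc a b) t ≤
          -(ν / 2) * ladderF ν (n + 2) f (u t) + (c ^ 2 / (2 * ν) * A ^ 2 + ν / 2 * (Λ + 1)) * ladderF ν (n + 1) f (u t) := by
  obtain ⟨c, hc0, hc⟩ := exists_ladder_inequality_sup_sq d n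
  refine ⟨c, hc0, fun {a b ν f u p} h hab hν Λ hΛ hcut t ht A hA => ?_⟩
  have h1 := hc h hab hν ht A hA
  -- the derivative of `½F` is that of `½E(u)` (time-independent forcing)
  have hfun : (fun s => 2⁻¹ * ladderF ν (n + 1) f (u s)) =
      fun s => 2⁻¹ * wordEnergy (n + 1) (u s) + 2⁻¹ * (ν⁻¹ ^ 2 * wordEnergy (n + 1) f) := by
    funext s; unfold ladderF; ring
  have hderiv : derivWithin (fun s => 2⁻¹ * ladderF ν (n + 1) f (u s)) (Icc a b) t =
      derivWithin (fun s => 2⁻¹ * wordEnergy (n + 1) (u s)) (Icc a b) t := by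
    rw [hfun]
    have h2 := h.hasDerivWithinAt_half_wordEnergy hab (n + 1) ht
    rw [(h2.add_const (2⁻¹ * (ν⁻¹ ^ 2 * wordEnergy (n + 1) f))).derivWithin (uniqueDiffOn_Icc hab t ht),
      h2.derivWithin (uniqueDiffOn_Icc hab t ht)]
  rw [hderiv]
  refine h1.trans ?_
  have hE1 : 0 ≤ wordEnergy (n + 1) (u t) := wordEnergy_nonneg _ _
  have hE2 : 0 ≤ wordEnergy (n + 2) (u t) := wordEnergy_nonneg _ _
  have hΦ1 : 0 ≤ wordEnergy (n + 1) f := wordEnergy_nonneg _ _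
  have hνi : 0 < ν⁻¹ := inv_pos.2 hν
  -- forcing: `√E √Φ ≤ (ν/2) F`
  have hforce : Real.sqrt (wordEnergy (n + 1) (u t)) * Real.sqrt (wordEnergy (n + 1) f) ≤
      ν / 2 * ladderF ν (n + 1) f (u t) := by
    unfold ladderF
    set σ₁ : ℝ := Real.sqrt (wordEnergy (n + 1) (u t)) with hσ₁
    set σ₂ : ℝ := Real.sqrt (wordEnergy (n + 1) f) with hσ₂
    have e1 : σ₁ ^ 2 = wordEnergy (n + 1) (u t) := Real.sq_sqrt hE1
    have e2 : σ₂ ^ 2 = wordEnergy (n + 1) f := Real.sq_sqrt hΦ1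
    rw [← e1, ← e2]
    have e : ν / 2 * (σ₁ ^ 2 + ν⁻¹ ^ 2 * σ₂ ^ 2) - σ₁ * σ₂ = ν / 2 * (σ₁ - ν⁻¹ * σ₂) ^ 2 := by
      field_simp
      ring
    have : 0 ≤ ν / 2 * (σ₁ - ν⁻¹ * σ₂) ^ 2 := by positivity
    linarith
  -- viscous term with the cutoff
  have hvisc : -(ν / 2) * wordEnergy (n + 2) (u t) ≤
      -(ν / 2) * ladderF ν (n + 2) f (u t) + ν / 2 * Λ * ladderF ν (n + 1) f (u t) := by
    unfold ladderF
    have h2 : ν⁻¹ ^ 2 * wordEnergy (n + 2) f ≤ Λ * (wordEnergy (n + 1) (u t) + ν⁻¹ ^ 2 * wordEnergy (n + 1) f) := by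
      calc ν⁻¹ ^ 2 * wordEnergy (n + 2) f ≤ ν⁻¹ ^ 2 * (Λ * wordEnergy (n + 1) f) :=
            mul_le_mul_of_nonneg_left hcut (sq_nonneg _)
        _ = Λ * (ν⁻¹ ^ 2 * wordEnergy (n + 1) f) := by ring
        _ ≤ Λ * (wordEnergy (n + 1) (u t) + ν⁻¹ ^ 2 * wordEnergy (n + 1) f) :=
            mul_le_mul_of_nonneg_left (le_add_of_nonneg_left hE1) hΛ
    nlinarith [h2, hν]
  -- the `A²` term: `E ≤ F`
  have hA2 : c ^ 2 / (2 * ν) * A ^ 2 * wordEnergy (n + 1) (u t) ≤ c ^ 2 / (2 * ν) * A ^ 2 * ladderF ν (n + 1) f (u t) := by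
    refine mul_le_mul_of_nonneg_left ?_ (by positivity)
    unfold ladderF
    exact le_add_of_nonneg_right (mul_nonneg (sq_nonneg _) hΦ1)
  linarith

/-- **(E6.9) as printed**, with Lemma 6.3: under the hypotheses of `exists_ladderF_inequality_sup` and
`1 ≤ s ≤ n + 1`, at times where `F_{n+1−s} > 0`,
`d/dt ½F_{n+1} ≤ −(ν/2) F_{n+1}^{1+1/s}/F_{n+1−s}^{1/s} + (c²(2ν)⁻¹ A² + (ν/2)(Λ+1)) F_{n+1}`.
[cite: DoeringGibbon1995, Ch. 6 Exercise 3 (E6.9)] -/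
theorem exists_ladderF_inequality_sup_rpow (d : Type*) [Fintype d] [DecidableEq d] (n : ℕ) :
    ∃ c : ℝ, 0 ≤ c ∧ ∀ {a b ν : ℝ} {f : UnitAddTorus d → EuclideanSpace ℝ d} {u : ℝ → UnitAddTorus d → EuclideanSpace ℝ d}
      {p : ℝ → UnitAddTorus d → ℝ}, Torus.IsClassicalNSSolutionOn (Icc a b) ν (fun _ => f) u p → a < b → 0 < ν →
      ∀ {Λ : ℝ}, 0 ≤ Λ → wordEnergy (n + 2) f ≤ Λ * wordEnergy (n + 1) f → ∀ {t : ℝ}, t ∈ Icc a b → ∀ A : ℝ,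
        (∀ x, ‖u t x‖ ≤ A) → ∀ {s : ℕ}, 1 ≤ s → s ≤ n + 1 → 0 < ladderF ν (n + 1 - s) f (u t) →
        derivWithin (fun s => 2⁻¹ * ladderF ν (n + 1) f (u s)) (Icc a b) t ≤
          -(ν / 2) * (ladderF ν (n + 1) f (u t) ^ (1 + 1 / (s : ℝ)) / ladderF ν (n + 1 - s) f (u t) ^ (1 / (s : ℝ))) +
            (c ^ 2 / (2 * ν) * A ^ 2 + ν / 2 * (Λ + 1)) * ladderF ν (n + 1) f (u t) := by
  obtain ⟨c, hc0, hc⟩ := exists_ladderF_inequality_sup d n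
  refine ⟨c, hc0, fun {a b ν f u p} h hab hν Λ hΛ hcut t ht A hA s hs1 hsN hpos => ?_⟩
  have hut : IsSmooth (u t) := h.smooth_velocity.isSmooth_slice ht
  have hf : IsSmooth f := by
    have ha : a ∈ Icc a b := left_mem_Icc.2 hab.le
    have hua : IsSmooth (u a) := h.smooth_velocity.isSmooth_slice ha
    have hfun : f = fun x => Torus.timeDerivWithin (Icc a b) u a x +
        Torus.convect (u a) (u a) x - ν • Torus.laplacian (u a) x + Torus.gradient (p a) x := by
      funext x
      rw [h.momentum a ha x]
      abel
    rw [hfun]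
    exact (((h.smooth_velocity.isSmooth_timeDerivWithin (uniqueDiffOn_Icc hab) ha).add (hua.convect hua)).sub
      (hua.laplacian.smul ν)).add (h.smooth_pressure.isSmooth_slice ha).gradient
  have h1 := hc h hab hν hΛ hcut ht A hA
  -- Lemma 6.3 with `r = 1`: `F_{n+1}^{1+s} ≤ F_{n+1−s} F_{n+2}^s`, then `1/s`-th roots
  have hL := ladderF_pow_le_pow_mul_pow hf hut ν (N := n + 1) hsN 1
  rw [pow_one, show n + 1 + 1 = n + 2 by ring] at hL
  have hF0 : 0 ≤ ladderF ν (n + 1) f (u t) :=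
    add_nonneg (wordEnergy_nonneg _ _) (mul_nonneg (sq_nonneg _) (wordEnergy_nonneg _ _))
  have hF2 : 0 ≤ ladderF ν (n + 2) f (u t) :=
    add_nonneg (wordEnergy_nonneg _ _) (mul_nonneg (sq_nonneg _) (wordEnergy_nonneg _ _))
  have hs0 : (0 : ℝ) < s := by exact_mod_cast hs1
  have hroot : ladderF ν (n + 1) f (u t) ^ (1 + 1 / (s : ℝ)) ≤
      ladderF ν (n + 1 - s) f (u t) ^ (1 / (s : ℝ)) * ladderF ν (n + 2) f (u t) := by
    have h2 := Real.rpow_le_rpow (pow_nonneg hF0 _) hL (le_of_lt (one_div_pos.2 hs0))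
    rw [Real.mul_rpow hpos.le (pow_nonneg hF2 _), ← Real.rpow_natCast, ← Real.rpow_natCast,
      ← Real.rpow_mul hF0, ← Real.rpow_mul hF2] at h2
    have e1 : ((1 + s : ℕ) : ℝ) * (1 / (s : ℝ)) = 1 + 1 / (s : ℝ) := by
      push_cast
      field_simp
      ring
    have e2 : ((s : ℕ) : ℝ) * (1 / (s : ℝ)) = 1 := by
      field_simp
    rwa [e1, e2, Real.rpow_one] at h2
  have hX : ladderF ν (n + 1) f (u t) ^ (1 + 1 / (s : ℝ)) / ladderF ν (n + 1 - s) f (u t) ^ (1 / (s : ℝ)) ≤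
      ladderF ν (n + 2) f (u t) := by
    rw [div_le_iff₀ (Real.rpow_pos_of_pos hpos _), mul_comm]
    exact hroot
  have hvisc : -(ν / 2) * ladderF ν (n + 2) f (u t) ≤
      -(ν / 2) * (ladderF ν (n + 1) f (u t) ^ (1 + 1 / (s : ℝ)) / ladderF ν (n + 1 - s) f (u t) ^ (1 / (s : ℝ))) :=
    mul_le_mul_of_nonpos_left hX (by linarith)
  linarith
end Torus

end Literature.Analysis.FluidPDE

end
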